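import Summits.NavierStokesRegularity.NavierStokesRegularity.Theorems.CircuitPump.Negative.LoadBearing
import Literature.Analysis.ODE.OneSidedComparison

/-!
# Gate flip of the damped Toda transfer gate: the abstract bootstrap
# (crux `PerpetualPump.CircuitPump`, stmt-NavierStokesRegularity-1834;
# line `singular-clock-gspt`, helper for the sub-goal `toda_gate_flip` of `stub_clockBox`)

The flip of the gate `u' = −u − v² + p`, `v' = v(u − w) − v + s`, `w' = −νw + v² + r` is a
statement about three scalar functions of time: with `D = u − w`, `R = √(D² + 2v²)`, `G = R + D`,
`H = R − D` (so `GH = 2v²`, `G + H = 2R`), the gate ODE gives EXACTLY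
`Ġ = −G(1 + H) + XG + 2vs/R`, `Ḣ = H(G − 1) − XH + 2vs/R`, `X = ((ν−1)w + p − r)/R`,
whence, as long as `R ≥ A/3` and `(ν−1)w + p − r ≤ 1.01A` (`X ≤ 3.03`),
`Ġ ≤ −G(1 + H − 3.03) + 2P` and `Ḣ ≥ H(G − 1 − 3.03)`.
`toda_gate_flip_dynamics` is the resulting continuity argument on `[tg, T]`, for abstract
`G, H, v` (continuous, right-differentiable, with these differential inequalities,
`2A/3 ≤ G + H ≤ 3A`, `2v ≤ G + H`, `v̇ ≤ v((G − H)/2 − 1) + P`), started from `G(tg) ≥ A/3`,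
`H(tg) ≥ A/192`:

* phase 1 (`maximalTimeP` of `G ≥ A/6`): there `Ḣ ≥ (2A/13)H`, so `H ≥ (A/192)e^{2A(t−tg)/13}`;
  since `H ≤ 3A` and `e^{16} ≥ 5⁴ > 576`, the phase ends (exit value `G = A/6`) before
  `tg + 104/A`;
* phase 2 (`maximalTimeP` of `G ≤ A/5` from there): `H ≥ 7A/15`, `Ġ ≤ −(2A/5)G + 2P`, so
  `G ≤ (A/6)e^{−2A(t−t₁)/5} + 5P/A < A/5` — the condition never exits, the decay holds up to `T`;
* phase 3: for `t ≥ tg + 250/A`, `G ≤ A/300 ≤ (G+H)/20`; and from `t₁ + 5/A` on,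
  `(G−H)/2 − 1 ≤ −A/4`, so `v ≤ 4P/A + (3A/2)e^{−(A/4)(t − t₁ − 5/A)}`, which is at most
  `8P/A + A e^{−(A/4)(t − tg − 250/A)}`.

Tools: `Literature/Analysis/ODE/MaximalTime.lean`, `OneSidedComparison.lean` (exponential
barriers, first-exit times). Everything here is folklore real analysis.
-/

noncomputable section

-- the summit namespace `…NavierStokesRegularity.NavierStokesRegularity…` is the tree convention
set_option linter.dupNamespace false

namespace Summit.NavierStokesRegularity.NavierStokesRegularity.Theorems.PerpetualPumpCircuitPump

open Set Filter Topology Literature.Analysis.ODE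

/-- `(1 + x/4)⁴ ≤ eˣ` for `x ≥ 0`. [folklore] -/
theorem flip_one_add_div_four_pow_le_exp {x : ℝ} (hx : 0 ≤ x) :
    (1 + x / 4) ^ 4 ≤ Real.exp x := by
  have h := Real.add_one_le_exp (x / 4)
  have h4 : Real.exp x = Real.exp (x / 4) ^ 4 := by
    rw [← Real.exp_nat_mul]; congr 1; push_cast; ring
  rw [h4]
  exact pow_le_pow_left₀ (by linarith) (by linarith) 4

/-- `e^{-x} ≤ 1/(1+x)` for `x ≥ 0`. [folklore] -/
theorem flip_exp_neg_le_one_div {x : ℝ} (hx : 0 ≤ x) : Real.exp (-x) ≤ 1 / (1 + x) := by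
  rw [Real.exp_neg, ← one_div]
  exact one_div_le_one_div_of_le (by linarith) (by linarith [Real.add_one_le_exp x])

/-- **Flip dynamics (abstract continuity argument).** Scalar functions `G, H, v ≥ 0` on `[tg, T]`,
continuous with right derivatives `G', H', v'` on `[tg, T)`, with `2A/3 ≤ G + H ≤ 3A`, `2v ≤ G + H`,
`G' ≤ −G(1 + H − 3.03) + 2P`, `H' ≥ H(G − 1 − 3.03)`, `v' ≤ v((G − H)/2 − 1) + P`, started from
`G(tg) ≥ A/3`, `H(tg) ≥ A/192` (`A ≥ 10⁴`, `0 ≤ P ≤ A/10⁴`, `tg + 250/A ≤ T`): for every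
`t ∈ [tg + 250/A, T]`, `G ≤ (G + H)/20` and `v ≤ A e^{−(A/4)(t − tg − 250/A)} + 8P/A`. [folklore] -/
theorem toda_gate_flip_dynamics :
    ∀ (A P tg T : ℝ) (G H v G' H' v' : ℝ → ℝ),
    10000 ≤ A → 0 ≤ P → 10000 * P ≤ A →
    ContinuousOn G (Set.Icc tg T) → ContinuousOn H (Set.Icc tg T) →
    ContinuousOn v (Set.Icc tg T) →
    (∀ t ∈ Set.Ico tg T, HasDerivWithinAt G (G' t) (Set.Ici t) t) →
    (∀ t ∈ Set.Ico tg T, HasDerivWithinAt H (H' t) (Set.Ici t) t) →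
    (∀ t ∈ Set.Ico tg T, HasDerivWithinAt v (v' t) (Set.Ici t) t) →
    (∀ t ∈ Set.Icc tg T, 0 ≤ G t) → (∀ t ∈ Set.Icc tg T, 0 ≤ H t) →
    (∀ t ∈ Set.Icc tg T, 2 * A / 3 ≤ G t + H t ∧ G t + H t ≤ 3 * A) →
    (∀ t ∈ Set.Icc tg T, 0 ≤ v t) → (∀ t ∈ Set.Icc tg T, 2 * v t ≤ G t + H t) →
    (∀ t ∈ Set.Ico tg T, G' t ≤ -(G t * (1 + H t - 303 / 100)) + 2 * P) →
    (∀ t ∈ Set.Ico tg T, H t * (G t - 1 - 303 / 100) ≤ H' t) →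
    (∀ t ∈ Set.Ico tg T, v' t ≤ v t * ((G t - H t) / 2 - 1) + P) →
    A / 3 ≤ G tg → A / 192 ≤ H tg → tg + 250 / A ≤ T →
    ∀ t ∈ Set.Icc (tg + 250 / A) T, G t ≤ (G t + H t) / 20 ∧
      v t ≤ A * Real.exp (-(A / 4) * (t - (tg + 250 / A))) + 8 * P / A := by
  intro A P tg T G H v G' H' v' hA hP hPA hGc hHc hvc hGd hHd hvd hG0 hH0 hsum hv0 hvR hG' hH' hv'
    hGtg hHtg htgT
  have hApos : 0 < A := by linarith
  have hPA' : P / A ≤ 1 / 10000 := by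
    rw [div_le_div_iff₀ hApos (by norm_num : (0:ℝ) < 10000)]; linarith
  have h250 : (0 : ℝ) < 250 / A := by positivity
  have htgT' : tg ≤ T := by linarith
  ---------------------------------------------------------------- Phase 1
  have hnegGc : ContinuousOn (fun t => -G t) (Icc tg T) := hGc.neg
  have hP1 : -G tg ≤ -(A / 6) := by linarith
  set t1 : ℝ := maximalTimeP (fun t => -G t ≤ -(A / 6)) tg T with ht1
  have ht1mem : t1 ∈ Icc tg T := maximalTimeP_le_const_mem (g := fun t => -G t) htgT' hP1
  have h1spec : ∀ t ∈ Icc tg t1, A / 6 ≤ G t := fun t ht => by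
    have := maximalTimeP_le_const_spec (g := fun t => -G t) htgT' hnegGc hP1 ht
    linarith
  -- H growth on [tg, t1]
  have hHgrow : ∀ t ∈ Icc tg t1, H tg * Real.exp (2 * A / 13 * (t - tg)) ≤ H t := by
    refine exp_mul_le_of_le_deriv_right (hHc.mono (Icc_subset_Icc_right ht1mem.2))
      (fun x hx => hHd x ⟨hx.1, hx.2.trans_le ht1mem.2⟩) ?_
    intro x hx
    have hGx : A / 6 ≤ G x := h1spec x (Ico_subset_Icc_self hx)
    have hHx : 0 ≤ H x := hH0 x ⟨hx.1, hx.2.le.trans ht1mem.2⟩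
    have h2 : 2 * A / 13 ≤ G x - 1 - 303 / 100 := by linarith
    have := hH' x ⟨hx.1, hx.2.trans_le ht1mem.2⟩
    nlinarith [mul_le_mul_of_nonneg_left h2 hHx]
  -- duration of phase 1
  have ht1lt : t1 < tg + 104 / A := by
    by_contra hcon
    push Not at hcon
    have h104pos : (0 : ℝ) ≤ 104 / A := by positivity
    have ht'mem : tg + 104 / A ∈ Icc tg t1 := ⟨by linarith, hcon⟩
    have hgrow := hHgrow _ ht'mem
    have hexp : (625 : ℝ) ≤ Real.exp (2 * A / 13 * (tg + 104 / A - tg)) := by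
      have : 2 * A / 13 * (tg + 104 / A - tg) = 16 := by field_simp; ring
      rw [this]
      calc (625 : ℝ) = (1 + 16 / 4) ^ 4 := by norm_num
        _ ≤ Real.exp 16 := flip_one_add_div_four_pow_le_exp (by norm_num)
    have hmem' : tg + 104 / A ∈ Icc tg T := ⟨ht'mem.1, hcon.trans ht1mem.2⟩
    have hHt' : H (tg + 104 / A) ≤ 3 * A := by
      have := (hsum _ hmem').2
      have := hG0 _ hmem'
      linarith
    have hHtg0 : 0 ≤ H tg := by linarith
    have : H tg * 625 ≤ H tg * Real.exp (2 * A / 13 * (tg + 104 / A - tg)) :=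
      mul_le_mul_of_nonneg_left hexp hHtg0
    nlinarith
  have h104 : tg + 104 / A ≤ T := by
    have : 104 / A ≤ 250 / A := div_le_div_of_nonneg_right (by norm_num) hApos.le
    linarith
  have ht1T : t1 < T := lt_of_lt_of_le ht1lt h104
  have hGt1 : G t1 = A / 6 := by
    have := eq_of_maximalTimeP_le_const_lt (g := fun t => -G t) htgT' hnegGc hP1 ht1T
    linarith
  ---------------------------------------------------------------- Phase 2
  have ht1T' : t1 ≤ T := ht1mem.2
  have hGc2 : ContinuousOn G (Icc t1 T) := hGc.mono (Icc_subset_Icc_left ht1mem.1)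
  have hP2 : G t1 ≤ A / 5 := by rw [hGt1]; linarith
  set t2 : ℝ := maximalTimeP (fun t => G t ≤ A / 5) t1 T with ht2
  have ht2mem : t2 ∈ Icc t1 T := maximalTimeP_le_const_mem (g := G) ht1T' hP2
  have h2spec : ∀ t ∈ Icc t1 t2, G t ≤ A / 5 := fun t ht =>
    maximalTimeP_le_const_spec (g := G) ht1T' hGc2 hP2 ht
  have hdecay : ∀ t ∈ Icc t1 t2,
      G t ≤ A / 6 * Real.exp (-(2 * A / 5) * (t - t1)) + 5 * P / A := by
    intro t ht
    have hsub : Icc t1 t2 ⊆ Icc tg T := Icc_subset_Icc ht1mem.1 ht2mem.2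
    have key := le_mul_exp_of_deriv_right_le (f := fun x => G x - 5 * P / A) (f' := G')
      (β := -(2 * A / 5)) (a := t1) (b := t2) ((hGc.mono hsub).sub continuousOn_const)
      (fun x hx => (hGd x ⟨ht1mem.1.trans hx.1, hx.2.trans_le ht2mem.2⟩).sub_const _) ?_ t ht
    · have h5P : (0 : ℝ) ≤ 5 * P / A := by positivity
      have hGt1' : G t1 - 5 * P / A ≤ A / 6 := by rw [hGt1]; linarith
      have hexp0 : 0 < Real.exp (-(2 * A / 5) * (t - t1)) := Real.exp_pos _
      have := mul_le_mul_of_nonneg_right hGt1' hexp0.le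
      linarith
    · intro x hx
      have hxT : x ∈ Icc tg T := ⟨ht1mem.1.trans hx.1, (hx.2.trans_le ht2mem.2).le⟩
      have hGx : G x ≤ A / 5 := h2spec x (Ico_subset_Icc_self hx)
      have hHx : 7 * A / 15 ≤ H x := by have := (hsum x hxT).1; linarith
      have hG0x := hG0 x hxT
      have h1 := hG' x ⟨ht1mem.1.trans hx.1, hx.2.trans_le ht2mem.2⟩
      have h2 : 2 * A / 5 ≤ 1 + H x - 303 / 100 := by linarith
      have h3 : G x * (2 * A / 5) ≤ G x * (1 + H x - 303 / 100) := mul_le_mul_of_nonneg_left h2 hG0x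
      have h4 : -(2 * A / 5) * (G x - 5 * P / A) = -(G x * (2 * A / 5)) + 2 * P := by
        field_simp; ring
      rw [h4]
      linarith
  have ht2T : t2 = T := by
    by_contra hne
    have hlt : t2 < T := lt_of_le_of_ne ht2mem.2 hne
    have hexit : G t2 = A / 5 := eq_of_maximalTimeP_le_const_lt (g := G) ht1T' hGc2 hP2 hlt
    have hd := hdecay t2 ⟨ht2mem.1, le_rfl⟩
    have hexp1 : Real.exp (-(2 * A / 5) * (t2 - t1)) ≤ 1 := by
      rw [Real.exp_le_one_iff]
      have : 0 ≤ t2 - t1 := by linarith [ht2mem.1]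
      nlinarith
    have h5 : 5 * P / A ≤ 5 / 10000 := by
      have : 5 * P / A = 5 * (P / A) := by ring
      rw [this]; linarith
    have : A / 6 * Real.exp (-(2 * A / 5) * (t2 - t1)) ≤ A / 6 :=
      (mul_le_mul_of_nonneg_left hexp1 (by positivity)).trans (le_of_eq (mul_one _))
    linarith
  have hdecayT : ∀ t ∈ Icc t1 T,
      G t ≤ A / 6 * Real.exp (-(2 * A / 5) * (t - t1)) + 5 * P / A := by
    rw [← ht2T]; exact hdecay
  ---------------------------------------------------------------- Phase 3
  have h5PA : 5 * P / A ≤ 5 / 10000 := by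
    have : 5 * P / A = 5 * (P / A) := by ring
    rw [this]; linarith
  intro t ht
  have h146 : (0 : ℝ) ≤ 146 / A := by positivity
  have h141 : (0 : ℝ) ≤ 141 / A := by positivity
  have h5A : (0 : ℝ) ≤ 5 / A := by positivity
  have h104pos : (0 : ℝ) ≤ 104 / A := by positivity
  have htT : t ∈ Icc tg T := ⟨by linarith [ht.1], ht.2⟩
  have ht1t : t1 + 146 / A ≤ t := by
    have : 146 / A + 104 / A = 250 / A := by rw [← add_div]; norm_num
    linarith [ht.1]
  constructor
  · have hd := hdecayT t ⟨by linarith, ht.2⟩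
    have hx : (292 / 5 : ℝ) ≤ 2 * A / 5 * (t - t1) := by
      have h1 : 2 * A / 5 * (146 / A) = 292 / 5 := by field_simp; ring
      have h2 : 2 * A / 5 * (146 / A) ≤ 2 * A / 5 * (t - t1) :=
        mul_le_mul_of_nonneg_left (by linarith) (by positivity)
      linarith
    have hexp : Real.exp (-(2 * A / 5) * (t - t1)) ≤ 1 / 59 := by
      have h0 : (0 : ℝ) ≤ 2 * A / 5 * (t - t1) := by linarith
      calc Real.exp (-(2 * A / 5) * (t - t1)) = Real.exp (-(2 * A / 5 * (t - t1))) := by ring_nf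
        _ ≤ 1 / (1 + 2 * A / 5 * (t - t1)) := flip_exp_neg_le_one_div h0
        _ ≤ 1 / 59 := one_div_le_one_div_of_le (by norm_num) (by linarith)
    have h1 : A / 6 * Real.exp (-(2 * A / 5) * (t - t1)) ≤ A / 6 * (1 / 59) :=
      mul_le_mul_of_nonneg_left hexp (by positivity)
    have := (hsum t htT).1
    linarith
  · -- v decay from t3 = t1 + 5/A
    set t3 : ℝ := t1 + 5 / A with ht3
    have ht3tg : tg ≤ t3 := by rw [ht3]; linarith [ht1mem.1]
    have ht3t : t3 + 141 / A ≤ t := by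
      have : 5 / A + 141 / A = 146 / A := by rw [← add_div]; norm_num
      rw [ht3]; linarith
    have ht3T : t3 ≤ T := by linarith [ht.2]
    have hsub3 : Icc t3 T ⊆ Icc tg T := Icc_subset_Icc_left ht3tg
    -- the rate on [t3, T)
    have hrate : ∀ x ∈ Ico t3 T, v' x ≤ -(A / 4) * (v x - 4 * P / A) := by
      intro x hx
      have hxT : x ∈ Icc tg T := ⟨ht3tg.trans hx.1, hx.2.le⟩
      have hx1 : t1 ≤ x := by have := hx.1; rw [ht3] at this; linarith
      have hGx := hdecayT x ⟨hx1, hx.2.le⟩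
      have hexp : Real.exp (-(2 * A / 5) * (x - t1)) ≤ 1 / 3 := by
        have h0 : (2 : ℝ) ≤ 2 * A / 5 * (x - t1) := by
          have h1 : 2 * A / 5 * (5 / A) = 2 := by field_simp
          have hx1' : 5 / A ≤ x - t1 := by have := hx.1; rw [ht3] at this; linarith
          have h2 : 2 * A / 5 * (5 / A) ≤ 2 * A / 5 * (x - t1) :=
            mul_le_mul_of_nonneg_left hx1' (by positivity)
          linarith
        calc Real.exp (-(2 * A / 5) * (x - t1)) = Real.exp (-(2 * A / 5 * (x - t1))) := by ring_nf
          _ ≤ 1 / (1 + 2 * A / 5 * (x - t1)) := flip_exp_neg_le_one_div (by linarith)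
          _ ≤ 1 / 3 := one_div_le_one_div_of_le (by norm_num) (by linarith)
      have h1 : A / 6 * Real.exp (-(2 * A / 5) * (x - t1)) ≤ A / 6 * (1 / 3) :=
        mul_le_mul_of_nonneg_left hexp (by positivity)
      have hsx := (hsum x hxT).1
      have hcoef : (G x - H x) / 2 - 1 ≤ -(A / 4) := by linarith
      have hv0x := hv0 x hxT
      have h2 : v x * ((G x - H x) / 2 - 1) ≤ v x * (-(A / 4)) :=
        mul_le_mul_of_nonneg_left hcoef hv0x
      have h3 := hv' x ⟨ht3tg.trans hx.1, hx.2⟩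
      have h4 : -(A / 4) * (v x - 4 * P / A) = v x * (-(A / 4)) + P := by field_simp; ring
      rw [h4]
      linarith
    have key := le_mul_exp_of_deriv_right_le (f := fun x => v x - 4 * P / A) (f' := v')
      (β := -(A / 4)) (a := t3) (b := T) ((hvc.mono hsub3).sub continuousOn_const)
      (fun x hx => (hvd x ⟨ht3tg.trans hx.1, hx.2⟩).sub_const _) hrate t ⟨by linarith, ht.2⟩
    -- v t3 ≤ 3A/2
    have hvt3 : v t3 ≤ 3 * A / 2 := by
      have h1 := hvR t3 ⟨ht3tg, ht3T⟩
      have h2 := (hsum t3 ⟨ht3tg, ht3T⟩).2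
      linarith
    have h4P : (0 : ℝ) ≤ 4 * P / A := by positivity
    have hvt3' : v t3 - 4 * P / A ≤ 3 * A / 2 := by linarith
    -- split the exponential
    have hY : 0 ≤ tg + 104 / A - t1 := by linarith [ht1lt]
    have hsplit : Real.exp (-(A / 4) * (t - t3)) =
        Real.exp (-(A / 4 * (141 / A + (tg + 104 / A - t1)))) *
          Real.exp (-(A / 4) * (t - (tg + 250 / A))) := by
      rw [← Real.exp_add]; congr 1; rw [ht3]; field_simp; ring
    have hE1 : Real.exp (-(A / 4 * (141 / A + (tg + 104 / A - t1)))) ≤ 1 / 36 := by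
      have hx : (141 / 4 : ℝ) ≤ A / 4 * (141 / A + (tg + 104 / A - t1)) := by
        have h1 : A / 4 * (141 / A + (tg + 104 / A - t1)) =
            141 / 4 + A / 4 * (tg + 104 / A - t1) := by field_simp
        rw [h1]
        have : 0 ≤ A / 4 * (tg + 104 / A - t1) := mul_nonneg (by positivity) hY
        linarith
      calc Real.exp (-(A / 4 * (141 / A + (tg + 104 / A - t1))))
          ≤ 1 / (1 + A / 4 * (141 / A + (tg + 104 / A - t1))) := flip_exp_neg_le_one_div (by linarith)
        _ ≤ 1 / 36 := one_div_le_one_div_of_le (by norm_num) (by linarith)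
    have hE2 : 0 < Real.exp (-(A / 4) * (t - (tg + 250 / A))) := Real.exp_pos _
    have hE0 : 0 < Real.exp (-(A / 4) * (t - t3)) := Real.exp_pos _
    -- assemble
    have h1 : (v t3 - 4 * P / A) * Real.exp (-(A / 4) * (t - t3)) ≤
        3 * A / 2 * Real.exp (-(A / 4) * (t - t3)) := mul_le_mul_of_nonneg_right hvt3' hE0.le
    have h2 : 3 * A / 2 * Real.exp (-(A / 4) * (t - t3)) ≤
        3 * A / 2 * (1 / 36) * Real.exp (-(A / 4) * (t - (tg + 250 / A))) := by
      rw [hsplit, ← mul_assoc]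
      exact mul_le_mul_of_nonneg_right (mul_le_mul_of_nonneg_left hE1 (by positivity)) hE2.le
    have h3 : 3 * A / 2 * (1 / 36) * Real.exp (-(A / 4) * (t - (tg + 250 / A))) ≤
        A * Real.exp (-(A / 4) * (t - (tg + 250 / A))) :=
      mul_le_mul_of_nonneg_right (by linarith) hE2.le
    have h4 : 4 * P / A ≤ 8 * P / A := div_le_div_of_nonneg_right (by linarith) hApos.le
    linarith

end Summit.NavierStokesRegularity.NavierStokesRegularity.Theorems.PerpetualPumpCircuitPump
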